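import Mathlib.Analysis.Calculus.Deriv.Mul
import Mathlib.Analysis.Calculus.Deriv.Comp
import Mathlib.Analysis.Calculus.Deriv.Add
import Mathlib.Analysis.Calculus.Deriv.Pow
import Mathlib.Analysis.Matrix.Normed
import Mathlib.Analysis.Complex.Basic
import Literature.MathematicalPhysics.QuantumFieldTheory.Volkov2020.AppendixDiracNumerators
import Literature.MathematicalPhysics.QuantumFieldTheory.Volkov2020.DiracMatrixModel
import Literature.MathematicalPhysics.QuantumFieldTheory.Volkov2024PRD109.OnShellEquivalenceWardCancellation
import HarnessLib

/-!
# Volkov PRD 109, 036012 (2024) §II requirement 1 «U_j PRESERVE THE WARD IDENTITY» and PRD 110, 036001 (2024) §III eq. (6)–(7) «then (UΓ)_μ(p,0) = −e ∂(UΣ)(p)/∂p^μ is also satisfied» — the ANALYTIC step behind the on-shell-equivalence cancellations, PROVED for every Clifford family in a non-trivial normed real algebra: ∂Σ/∂p^μ computed from (13); the Ward identity forces (a, b, c, d) = (−e s, −2e r′, −2e s′, 0) in (8); hence «U_j′Γ = −U_j′Σ», §IV B's «L′Γ₁ = −B′Σ₁», the §IV B corollaries for the printed weighted families, and gen 34's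 TABLE I cancellation from the printed Ward identities themselves — with ONE PRINT-CHECK DATUM (§II p.6's «U_j′Σ = −s(M²)» satisfies requirement 1 iff s(M²) = 0; §V p.20 and PRD 110 (7) print the consistent sign)

independent recomputation; certified where stated, statistical where stated; no new-physics claim.

CITATION HEADER (venture `QEDPrecision`, cell `pub-qed`, track TROPICAL seat V3b = `pub-qed-trop-v3-lit-2` gen 35; VALUE-FREE: identities between
printed OPERATOR FORMULAS on abstract amplitude shapes in an abstract γ-algebra and in M₄(ℂ) — no integral, no graph of the cell, nothing per word,
nothing of X352). Companion of `Volkov2024PRD109.OnShellEquivalenceWardCancellation` (gen 34: §IV B TABLE I summed and cancelled UNDER the four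
printed Ward corollaries taken as hypotheses — «they are consequences of Ward identities for amplitudes — analysis, not typed here») and of
`Volkov2024PRD109.ForestFormulaCases` (the printed operator CASE TABLES — «no operator CONTENT is typed in this file»): this file types the CONTENT
of U, L, B, M′ on the printed amplitude shapes (8), (13) and derives those corollaries from the printed Ward identities. Serves HOME
`tropical/view/V3-VOLKOV-DEGREES.md` §B B.4 / B.61 and HOME `irse/lit/VOLKOV-IR-EXTRACT-lit.md` §5 (the ⟦lit⟧ sign reading, here a theorem).

Sources, VERBATIM (LaTeX e-prints held by the cell, HOME `data/lit/sources/.cache/<arXiv id>/`; page:line = the arXiv PDF as materialised by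
`lit read arxiv:2308.11560` / the cell's extract for 2404.00649).
* [Volkov2024PRD109] S. Volkov, Phys. Rev. D 109, 036012 (2024) = arXiv:2308.11560v4 (`method_details_2023.tex`). §II p.4 (tex l.215): «the Dirac
  matrices satisfy the condition γ_μγ_ν + γ_νγ_μ = 2g_{μν}. We also suppose e = 1 for the lepton electric charge». §II p.5 L27–L30 (tex l.236–243):
  «L is the standard on-shell renormalization operator for vertexlike graphs; it is defined as (LΓ)_μ(p,q) = [L′Γ]γ_μ, L′Γ = a(m²) + mb(m²) +
  m²c(m²), where (8) Γ_μ(p,0) = a(p²)γ_μ + b(p²)p_μ + c(p²)p̸p_μ + d(p²)(p̸γ_μ − γ_μp̸).» §II p.6 L10–L19 (tex l.263–277): «U_j, j = 1,2 are applied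
  to vertexlike and lepton self-energy Feynman amplitudes … They are defined as (U_jΓ)_μ(p,q) = [U_j′Γ]γ_μ, (12) (U_jΣ)(p) = M′Σ + (U_j′Σ)×(p̸ − m)
  where Γ_μ(p,q) and Σ(p) are vertexlike and lepton self-energy Feynman amplitudes, U_j′ are number-valued linear operators, (13) Σ(p) = r(p²) +
  s(p²)p̸. (14) M′Σ = r(m²) + s(m²)m.» §II p.6 L20–L31 (tex l.279–294): «We require that: 1. U_j (j = 1,2) preserve the Ward identity: if Γ_μ and Σ
  satisfy Γ_μ(p,0) = −∂Σ(p)/∂p^μ, then (U_jΓ)_μ(p,0) = −∂[(U_jΣ)(p)]/∂p^μ is also satisfied. The latter can be rewritten as U_j′Γ = −U_j′Σ. 2. If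
  Γ_μ(p,0) = 0, then U′_jΓ = 0 (j = 1,2,3).» §II p.6 L38–L40 (tex l.300–306): «To obtain finite integrals for each graph, more stringent requirements
  are needed. We take U_j′Γ = a(M²), U_j′Σ = −s(M²), j = 1,2, where (8), (13) are satisfied, M² is an arbitrary real number (it may be different for
  different operators). As U₃′Γ we can take a(M²) or L′Γ.» §IV A p.11 L22 (tex l.483): «(BΣ)(p) = [B′Σ]×(p̸ − m) + M′Σ, B′Σ = s(m²) + 2m
  ∂r(x)/∂x|_{x=m²} + 2m² ∂s(x)/∂x|_{x=m²}». §IV B p.12 (tex l.538–549): «We use the following Ward identities for individual graphs: (Γ₁)_μ(p,0) +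
  ∂Σ₁(p)/∂p^μ = 0, 2(Γ_M)_μ(p,0) + ∂Σ_M(p)/∂p^μ = 0, 2(Γ_λ)_μ(p,0) + (Γ_×)_μ(p,0) + ∂Σ_×(p)/∂p^μ = 0, 2(Γ_ρ)_μ(p,0) + (Γ_≈)_μ(p,0) + ∂Σ_≈(p)/∂p^μ
  = 0[.] Each identity contains one lepton self-energy graph and all vertexlike graphs obtained by inserting an external photon into a line on the
  main path. Each coefficient equals 1, but some of our coefficients equal 2, because we are working with undirected Feynman graphs. The identities can
  be proved by standard methods used in QED. The corollary is U₁′Γ₁ + U₁′Σ₁ = 0, 2U₁′Γ_M + U₁′Σ_M = 0, 2U₁′Γ_λ + U₁′Γ_× + U₁′Σ_× = 0, 2U₁′Γ_ρ + U₁′Γ_≈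
  + U₁′Σ_≈ = 0. From this it follows that all terms with U₁′ are cancelled.» §IV B p.14 L7, L15 (tex l.583, l.595): «With U₁′Γ₁ = −U₁′Σ₁, we get
  that all terms containing U₁′ are cancelled after summation. … It equals 0, because L′Γ₁ = −B′Σ₁.» §V p.20 L40 (tex l.775): «(U_jΓ)_μ(p,q) =
  a(−m²)γ_μ, (U_jΣ)(p) = s(−m²)(p̸ − m) + r(m²) + s(m²)m».
* [Volkov2024] S. Volkov, Phys. Rev. D 110, 036001 (2024) = arXiv:2404.00649v2 (`amm5_a1_all.tex`) §III p.8 L32–L44 (tex l.421–441): «If Γ_μ(p,q)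
  is a vertexlike Feynman amplitude, … Γ_μ(p,0) = a(p²)γ_μ + b(p²)p_μ + c(p²)p̸p_μ + d(p²)(p̸γ_μ − γ_μp̸) is satisfied, then put by definition (6)
  (UΓ)_μ(p,q) = a(M²)γ_μ, where M² is an arbitrary number. Similarly, for a lepton self-energy Feynman amplitude Σ(p) = r(p²) + s(p²)p̸ we define (7)
  (UΣ)(p) = r(m²) + s(m²)m + s(M²)(p̸ − m). The preservation of the Ward identity plays an important role in the equivalence of the subtraction
  method used with the on-shell renormalization: If Σ and Γ satisfy Γ_μ(p,0) = −e ∂Σ(p)/∂p^μ, where e is the lepton charge, then (UΓ)_μ(p,0) =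
  −e ∂(UΣ)(p)/∂p^μ is also satisfied. In old calculations we used M² = m². Here we use M² = −m²».

MODEL. γ : Fin 4 → A is a Clifford family (`Volkov2020.AppendixNumerators.IsDirac`: γ_μγ_ν + γ_νγ_μ = 2g_{μν}·1, g = diag(1,−1,−1,−1)) in a normed
real algebra A (the norm is needed only to speak of derivatives of A-valued functions; the extraction theorems assume A non-trivial); p : Fin 4 → ℝ
are the contravariant components p^μ, p̂ = `sl γ p` = Σ_μ p^μγ_μ, p_μ = `lo p μ` = g_{μμ}p^μ, p² = `dot p p` — the tree's vocabulary, REUSED. An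
amplitude «of the form (13)» is the PAIR of real coefficient functions (r, s) (differentiable; the derivatives r′, s′ of §IV A are carried:
`SelfEnergy`); «of the form (8)» is the quadruple (a, b, c, d) (`Vertex`); their values in A are `SelfEnergy.amp`, `Vertex.amp`. «∂/∂p^μ» = `pd` =
the derivative at t = 0 of t ↦ f(p + t·e_μ). The operators are typed as displayed: `Vertex.lPrime` (L′), `Vertex.uPrime` (U′Γ = a(M²)),
`SelfEnergy.mPrime` (M′), `SelfEnergy.bPrime` (B′), and for Σ the number `SelfEnergy.uPrime` = s(M²) — THE SIGN OF §V p.20 AND PRD 110 (7) — next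
to `SelfEnergy.uPrimeSecII` = −s(M²) AS PRINTED on p.6 L39; `uAmp` / `uAmpSecII` / `bAmp` / `lAmp` are (12), (12) with p.6's sign, (BΣ), (LΓ).

WHAT IS PROVED (namespace `…Volkov2024PRD109.WardPreservation`; 0 named facts):
* `hasDerivAt_selfEnergy` / **`pd_selfEnergy`** — ∂Σ(p)/∂p^μ = 2r′(p²)p_μ·1 + 2s′(p²)p_μ·p̂ + s(p²)·γ_μ (chain rule with ∂p²/∂p^μ = 2p_μ, and
  ∂p̂/∂p^μ = γ_μ; Mathlib's one-variable calculus along the coordinate line).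
* `WardIdentity` («Γ_μ(p,0) = −e ∂Σ(p)/∂p^μ»); `wardIdentity_wardVertex` — −e∂Σ/∂p^μ IS of the form (8) with (a,b,c,d) = (−e s, −2e r′, −2e s′, 0),
  so a Ward partner exists for every Σ (non-vacuity, any γ-algebra); **`WardIdentity.coeff`** — conversely the Ward identity FORCES these
  coefficients: the decomposition (8) is unique in every non-trivial γ-algebra (test momenta p(x) = ((x+1)/2, (x−1)/2, 0, 0), p(x)² = x for ALL real
  x; `indep_one_gamma`: 1, γ₀, γ₁ are ℝ-linearly independent — conjugate by γ₂, anticommute with γ₀, square γ₁).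
* **`u_preserves_ward`** — PRD 110 §III / requirement 1: Ward(Γ, Σ) ⇒ (UΓ)_μ(p,0) = −e ∂(UΣ)(p)/∂p^μ for (6)–(7), every M², m, p, μ;
  `uPrime_vertex_eq` — «U_j′Γ = −U_j′Σ» (a(M²) = −e s(M²)); `SelfEnergy.uAmp_eq_PRD110` ((7) literally), `SelfEnergy.uAmp_secV` (§V's display, M² =
  −m²), `SelfEnergy.uAmp_self` («In old calculations we used M² = m²»: then (UΣ)(p) = r(m²) + s(m²)p̸); `pd_uAmp`, `pd_bAmp`, `pd_uAmpSecII`.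
* **`lPrime_eq_neg_bPrime`** — §IV B «L′Γ₁ = −B′Σ₁» (L′Γ = −e B′Σ for every Ward pair); `lAmp_eq_neg_pd_bAmp` ((LΓ)_μ = −e ∂(BΣ)(p)/∂p^μ).
* `uPrime_lPrime_eq_zero_of_amp_eq_zero` — requirement 2: Γ_μ(p,0) ≡ 0 ⇒ U′Γ = a(M²) = 0 and L′Γ = 0 (both printed choices of U₃′).
* `WardFamily` (a printed per-graph identity Σ_i w_i (Γ_i)_μ(p,0) + ∂Σ(p)/∂p^μ = 0, integer weights), **`WardFamily.uPrime_corollary`** — «The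
  corollary is …»: Σ_i w_i U′Γ_i + U′Σ = 0; **`tableSum_eq_zero_of_wardFamilies`** — for ten amplitudes Γ₁, Γ_λ, Γ_ρ, Γ_×, Γ_≈, Γ_M, Σ₁, Σ_×, Σ_≈,
  Σ_M satisfying the four printed identities (weights (1), (2), (2,1), (2,1)) and ANY values A′Γ₁, A′Γ_λ, A′Γ_ρ, A′Γ_M, M′Σ₁, gen 34's
  `Set3Values.tableSum` (TABLE I) VANISHES — «From this it follows that all terms with U₁′ are cancelled», now from the Ward identities as printed.
* §6, the Dirac-matrix model (`Volkov2020.DiracModel.diracGamma`; M₄(ℂ) with Mathlib's ℓ∞-operator norm switched on SECTION-LOCALLY exactly as in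
  `Volkov2020.DiracMatrixModel`): `model_u_preserves_ward`, `model_wardIdentity` (Ward pairs exist: the hypotheses are met with content),
  `model_secII_sign_fails` (the datum is live there).
PRINT-CHECK DATUM (arXiv v4 = the held e-print; the journal page is not held by the cell): **`uPrime_eq_neg_uPrimeSecII_iff`** /
`uAmpSecII_preserves_ward_iff` — with p.6 L39's «U_j′Σ = −s(M²)» inserted in (12), requirement 1 («U_j′Γ = −U_j′Σ», resp. «(U_jΓ)_μ(p,0) =
−∂[(U_jΣ)(p)]/∂p^μ») holds for a Ward pair IF AND ONLY IF s(M²) = 0, whereas with U_j′Σ = +s(M²) — the sign the same paper prints in §V p.20 L40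
and PRD 110 prints in (7) — it holds for EVERY Ward pair (`uPrime_vertex_eq`, `u_preserves_ward`). Reading: the minus of p.6 L39 is a slip in one
display (equivalently (12) with «−(U_j′Σ)»); the operator of record is (7); every printed CONCLUSION (requirement 1, the §IV B corollaries and
cancellations, «L′Γ₁ = −B′Σ₁») is unaffected. (= the ⟦lit⟧ reading of HOME `irse/lit/VOLKOV-IR-EXTRACT-lit.md` §5, here a theorem.)
NOT CLAIMED (print / physics, not typed): that actual QED amplitudes have the forms (8), (13) and satisfy the Ward identities («can be proved by
standard methods used in QED»); U₀ (photonic subgraphs), U₃ beyond requirement 2, the AMM projector A′, the forest formula or §IV C; coefficient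
functions are REAL-valued here (every identity is ℝ-linear in (r, s, a, b, c, d) — TODO(general form): values in ℂ); nothing about any integral,
convergence, or value.
-/

noncomputable section

open Finset
open Literature.MathematicalPhysics.QuantumFieldTheory.Volkov2020.AppendixNumerators

namespace Literature.MathematicalPhysics.QuantumFieldTheory.Volkov2024PRD109

namespace WardPreservation

/-! ## §1 The printed amplitude shapes (8), (13) as coefficient data -/

/-- A lepton self-energy amplitude in the printed form (13) «Σ(p) = r(p²) + s(p²)p̸», with DIFFERENTIABLE real coefficient
functions r, s (their derivatives r′, s′ are carried as data, as §IV A's «∂r(x)/∂x|_{x=m²}» needs them).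
[cite: Volkov2024PRD109, §II eq. (13) (arXiv v4 p.6 L18; tex l.272–274)] -/
structure SelfEnergy where
  /-- r(x), x = p². -/
  r : ℝ → ℝ
  /-- s(x). -/
  s : ℝ → ℝ
  /-- r′(x). -/
  r' : ℝ → ℝ
  /-- s′(x). -/
  s' : ℝ → ℝ
  /-- r is differentiable with derivative r′. -/
  hr : ∀ x, HasDerivAt r (r' x) x
  /-- s is differentiable with derivative s′. -/
  hs : ∀ x, HasDerivAt s (s' x) x

/-- A vertexlike amplitude at zero photon momentum in the printed form (8)
«Γ_μ(p,0) = a(p²)γ_μ + b(p²)p_μ + c(p²)p̸p_μ + d(p²)(p̸γ_μ − γ_μp̸)»: its four real coefficient functions.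
[cite: Volkov2024PRD109, §II eq. (8) (arXiv v4 p.5 L30; tex l.241–243)] -/
structure Vertex where
  /-- a(x), x = p². -/
  a : ℝ → ℝ
  /-- b(x). -/
  b : ℝ → ℝ
  /-- c(x). -/
  c : ℝ → ℝ
  /-- d(x). -/
  d : ℝ → ℝ

variable {A : Type*} [NormedRing A] [NormedAlgebra ℝ A]

/-- Σ(p) = r(p²)·1 + s(p²)·p̸ as an element of the γ-algebra A (p = contravariant components p^μ, p̂ = `sl γ p`, p² = `dot p p`).
[cite: Volkov2024PRD109, §II eq. (13) (arXiv v4 p.6 L18; tex l.272–274)] -/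
def SelfEnergy.amp (S : SelfEnergy) (γ : Fin 4 → A) (p : Fin 4 → ℝ) : A :=
  S.r (dot p p) • (1 : A) + S.s (dot p p) • sl γ p

/-- Γ_μ(p,0) = a(p²)γ_μ + b(p²)p_μ·1 + c(p²)p_μ·p̂ + d(p²)(p̂γ_μ − γ_μp̂) (p_μ = `lo p μ`, the covariant component).
[cite: Volkov2024PRD109, §II eq. (8) (arXiv v4 p.5 L30; tex l.241–243)] -/
def Vertex.amp (V : Vertex) (γ : Fin 4 → A) (p : Fin 4 → ℝ) (μ : Fin 4) : A :=
  V.a (dot p p) • γ μ + (V.b (dot p p) * lo p μ) • (1 : A) + (V.c (dot p p) * lo p μ) • sl γ p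
    + V.d (dot p p) • (sl γ p * γ μ - γ μ * sl γ p)

/-- The partial derivative «∂f(p)/∂p^μ» of an A-valued function of the momentum: the derivative at t = 0 of t ↦ f(p + t·e_μ).
[cite: Volkov2024PRD109, §II requirement 1 «∂Σ(p)/∂p^μ» (arXiv v4 p.6 L21–L27; tex l.281–290)] -/
def pd (f : (Fin 4 → ℝ) → A) (p : Fin 4 → ℝ) (μ : Fin 4) : A :=
  deriv (fun t : ℝ => f (p + t • e μ)) 0

/-! ## §2 «∂Σ(p)/∂p^μ» computed: ∂Σ/∂p^μ = 2r′(p²)p_μ + 2s′(p²)p_μp̂ + s(p²)γ_μ -/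

/-- (p + t e_μ)² = p² + 2p_μ t + g_{μμ} t². [folklore] -/
private theorem dot_add_smul_e (p : Fin 4 → ℝ) (μ : Fin 4) (t : ℝ) :
    dot (p + t • e μ) (p + t • e μ) = dot p p + 2 * lo p μ * t + η μ * t ^ 2 := by
  fin_cases μ <;> simp [dot, lo, e, Fin.sum_univ_four] <;> ring

/-- (p + t e_μ)^ = p̂ + t γ_μ. [folklore] -/
private theorem sl_add_smul_e (γ : Fin 4 → A) (p : Fin 4 → ℝ) (μ : Fin 4) (t : ℝ) :
    sl γ (p + t • e μ) = sl γ p + t • γ μ := by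
  fin_cases μ <;> simp [sl, e, Fin.sum_univ_four, add_smul] <;> abel

/-- **The derivative of (13) along p^μ**: t ↦ Σ(p + t e_μ) has derivative 2r′(p²)p_μ·1 + 2s′(p²)p_μ·p̂ + s(p²)·γ_μ at t = 0
(chain rule on r(p²), s(p²) with ∂p²/∂p^μ = 2p_μ, and ∂p̂/∂p^μ = γ_μ).
[cite: Volkov2024PRD109, §II eq. (13) and requirement 1 (arXiv v4 p.6; tex l.272–292)] -/
theorem hasDerivAt_selfEnergy (S : SelfEnergy) (γ : Fin 4 → A) (p : Fin 4 → ℝ) (μ : Fin 4) :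
    HasDerivAt (fun t : ℝ => S.amp γ (p + t • e μ))
      ((2 * S.r' (dot p p) * lo p μ) • (1 : A) + (2 * S.s' (dot p p) * lo p μ) • sl γ p + S.s (dot p p) • γ μ) 0 := by
  -- the inner polynomial t ↦ (p + t e_μ)²
  have hq : HasDerivAt (fun t : ℝ => dot p p + 2 * lo p μ * t + η μ * t ^ 2) (2 * lo p μ) 0 := by
    have h1 : HasDerivAt (fun t : ℝ => 2 * lo p μ * t) (2 * lo p μ * 1) 0 := (hasDerivAt_id' (0 : ℝ)).const_mul _
    have h2 : HasDerivAt (fun t : ℝ => η μ * t ^ 2) (η μ * ((2 : ℕ) * (0 : ℝ) ^ (2 - 1))) 0 :=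
      (hasDerivAt_pow 2 (0 : ℝ)).const_mul _
    have h12 := (h1.fun_add h2).const_add (dot p p)
    have hfq : (fun t : ℝ => dot p p + 2 * lo p μ * t + η μ * t ^ 2) = fun t : ℝ => dot p p + (2 * lo p μ * t + η μ * t ^ 2) := by
      funext t; ring
    rw [hfq]
    refine h12.congr_deriv ?_
    simp
  have h0 : dot p p + 2 * lo p μ * 0 + η μ * (0 : ℝ) ^ 2 = dot p p := by simp
  -- r(q(t)) and s(q(t)) by the chain rule
  have hr : HasDerivAt (fun t : ℝ => S.r (dot p p + 2 * lo p μ * t + η μ * t ^ 2)) (S.r' (dot p p) * (2 * lo p μ)) 0 := by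
    have := (S.hr (dot p p + 2 * lo p μ * 0 + η μ * (0 : ℝ) ^ 2)).comp 0 hq
    rw [h0] at this
    exact this
  have hs : HasDerivAt (fun t : ℝ => S.s (dot p p + 2 * lo p μ * t + η μ * t ^ 2)) (S.s' (dot p p) * (2 * lo p μ)) 0 := by
    have := (S.hs (dot p p + 2 * lo p μ * 0 + η μ * (0 : ℝ) ^ 2)).comp 0 hq
    rw [h0] at this
    exact this
  -- the vector part t ↦ p̂ + t γ_μ
  have hv : HasDerivAt (fun t : ℝ => sl γ p + t • γ μ) ((1 : ℝ) • γ μ) 0 :=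
    ((hasDerivAt_id' (0 : ℝ)).smul_const (γ μ)).const_add _
  have hsum := (hr.smul_const (1 : A)).fun_add (hs.fun_smul hv)
  have hfun : ∀ t : ℝ, S.amp γ (p + t • e μ)
      = S.r (dot p p + 2 * lo p μ * t + η μ * t ^ 2) • (1 : A)
        + S.s (dot p p + 2 * lo p μ * t + η μ * t ^ 2) • (sl γ p + t • γ μ) := by
    intro t
    simp only [SelfEnergy.amp, dot_add_smul_e, sl_add_smul_e]
  have key : HasDerivAt (fun t : ℝ => S.amp γ (p + t • e μ))
      ((S.r' (dot p p) * (2 * lo p μ)) • (1 : A)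
        + (S.s (dot p p + 2 * lo p μ * 0 + η μ * (0 : ℝ) ^ 2) • ((1 : ℝ) • γ μ)
          + (S.s' (dot p p) * (2 * lo p μ)) • (sl γ p + (0 : ℝ) • γ μ))) 0 :=
    hsum.congr_of_eventuallyEq (Filter.Eventually.of_forall hfun)
  rw [h0] at key
  refine key.congr_deriv ?_
  simp only [one_smul, zero_smul, add_zero]
  module

/-- **∂Σ(p)/∂p^μ = 2r′(p²)p_μ + 2s′(p²)p_μ p̂ + s(p²)γ_μ.**
[cite: Volkov2024PRD109, §II eq. (13) and requirement 1 (arXiv v4 p.6; tex l.272–292)] -/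
theorem pd_selfEnergy (S : SelfEnergy) (γ : Fin 4 → A) (p : Fin 4 → ℝ) (μ : Fin 4) :
    pd (S.amp γ) p μ
      = (2 * S.r' (dot p p) * lo p μ) • (1 : A) + (2 * S.s' (dot p p) * lo p μ) • sl γ p + S.s (dot p p) • γ μ :=
  (hasDerivAt_selfEnergy S γ p μ).deriv

/-! ## §3 The Ward identity «Γ_μ(p,0) = −e ∂Σ(p)/∂p^μ» and what it forces on the coefficients -/

/-- **The Ward identity for a pair (Γ, Σ)** as printed: «Γ_μ(p,0) = −e ∂Σ(p)/∂p^μ, where e is the lepton charge» (PRD 110 §III;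
PRD 109 §II requirement 1 with e = 1, «We also suppose e = 1 for the lepton electric charge»).
[cite: Volkov2024, §III (arXiv v2 p.8 L42–L44; tex l.433–441)] [cite: Volkov2024PRD109, §II requirement 1 (arXiv v4 p.6 L20–L23; tex l.281–285)] -/
def WardIdentity (γ : Fin 4 → A) (el : ℝ) (V : Vertex) (S : SelfEnergy) : Prop :=
  ∀ (p : Fin 4 → ℝ) (μ : Fin 4), V.amp γ p μ = -(el • pd (S.amp γ) p μ)

/-- The vertex data READ OFF from −e ∂Σ/∂p^μ by §2: a = −e·s, b = −2e·r′, c = −2e·s′, d = 0.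
[cite: Volkov2024PRD109, §II eqs. (8), (13), requirement 1 (arXiv v4 p.5–6; tex l.241–292)] -/
def SelfEnergy.wardVertex (el : ℝ) (S : SelfEnergy) : Vertex where
  a := fun x => -(el * S.s x)
  b := fun x => -(2 * el * S.r' x)
  c := fun x => -(2 * el * S.s' x)
  d := fun _ => 0

/-- −e ∂Σ/∂p^μ IS of the form (8), with the coefficients of `wardVertex` — so the Ward identity is satisfiable for every Σ (non-vacuity),
in every γ-algebra. [cite: Volkov2024PRD109, §II eqs. (8), (13), requirement 1 (arXiv v4 p.5–6; tex l.241–292)] -/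
theorem wardIdentity_wardVertex (γ : Fin 4 → A) (el : ℝ) (S : SelfEnergy) : WardIdentity γ el (S.wardVertex el) S := by
  intro p μ
  simp only [Vertex.amp, SelfEnergy.wardVertex, pd_selfEnergy, zero_smul, add_zero, smul_add, neg_add, smul_smul]
  module

/-- The light-like-free test momentum p(x) = ((x+1)/2, (x−1)/2, 0, 0): p(x)² = x for EVERY real x and p(x) ≠ 0. [folklore] -/
def testMomentum (x : ℝ) : Fin 4 → ℝ := ![(x + 1) / 2, (x - 1) / 2, 0, 0]

/-- p(x)² = x. [folklore] -/
private theorem dot_testMomentum (x : ℝ) : dot (testMomentum x) (testMomentum x) = x := by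
  simp [dot, testMomentum, Fin.sum_univ_four]
  ring

/-- p(x)^ = ((x+1)/2)γ₀ + ((x−1)/2)γ₁. [folklore] -/
private theorem sl_testMomentum (γ : Fin 4 → A) (x : ℝ) :
    sl γ (testMomentum x) = ((x + 1) / 2) • γ 0 + ((x - 1) / 2) • γ 1 := by
  simp [sl, testMomentum, Fin.sum_univ_four]

/-- p(x)₀ = (x+1)/2. [folklore] -/
private theorem lo_testMomentum_zero (x : ℝ) : lo (testMomentum x) 0 = (x + 1) / 2 := by simp [lo, testMomentum]
/-- p(x)₁ = −(x−1)/2. [folklore] -/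
private theorem lo_testMomentum_one (x : ℝ) : lo (testMomentum x) 1 = -((x - 1) / 2) := by simp [lo, testMomentum]
/-- p(x)₂ = 0. [folklore] -/
private theorem lo_testMomentum_two (x : ℝ) : lo (testMomentum x) 2 = 0 := by simp [lo, testMomentum]

section Clifford

variable {γ : Fin 4 → A}

/-- γ_μγ_ν = −γ_νγ_μ for μ ≠ ν. [cite: Volkov2024PRD109, §II «the Dirac matrices satisfy the condition γ_μγ_ν + γ_νγ_μ = 2g_{μν}» (arXiv v4 p.4; tex l.215)] -/
theorem gamma_anticomm (hγ : IsDirac γ) {μ ν : Fin 4} (h : μ ≠ ν) : γ μ * γ ν = -(γ ν * γ μ) := by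
  have := hγ μ ν
  rw [if_neg h] at this
  exact eq_neg_of_add_eq_zero_left this

/-- γ_μ² = g_{μμ}·1. [cite: Volkov2024PRD109, §II «γ_μγ_ν + γ_νγ_μ = 2g_{μν}» (arXiv v4 p.4; tex l.215)] -/
theorem gamma_sq (hγ : IsDirac γ) (μ : Fin 4) : γ μ * γ μ = η μ • (1 : A) := by
  have h := hγ μ μ
  rw [if_pos rfl, ← two_smul ℝ (γ μ * γ μ), mul_smul] at h
  exact smul_right_injective A (two_ne_zero) h

/-- **Linear independence of 1, γ₀, γ₁** in any non-trivial γ-algebra: a·1 + b·γ₀ + c·γ₁ = 0 ⇒ a = b = c = 0 (conjugate by γ₂, which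
anticommutes with γ₀, γ₁, to flip the sign of a; anticommute with γ₀ to isolate b; square γ₁ for c). [folklore] -/
private theorem indep_one_gamma (hγ : IsDirac γ) [Nontrivial A] {a b c : ℝ} (h : a • (1 : A) + b • γ 0 + c • γ 1 = 0) :
    a = 0 ∧ b = 0 ∧ c = 0 := by
  have h00 : γ 0 * γ 0 = (1 : A) := by rw [gamma_sq hγ 0]; simp
  have h11 : γ 1 * γ 1 = -(1 : A) := by rw [gamma_sq hγ 1]; simp
  have h22 : γ 2 * γ 2 = -(1 : A) := by rw [gamma_sq hγ 2]; simp
  have h20 : γ 2 * γ 0 = -(γ 0 * γ 2) := gamma_anticomm hγ (by decide)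
  have h21 : γ 2 * γ 1 = -(γ 1 * γ 2) := gamma_anticomm hγ (by decide)
  have h01 : γ 0 * γ 1 = -(γ 1 * γ 0) := gamma_anticomm hγ (by decide)
  -- conjugation by γ₂
  have t0 : γ 2 * γ 0 * γ 2 = γ 0 := by rw [h20, neg_mul, mul_assoc, h22]; simp
  have t1 : γ 2 * γ 1 * γ 2 = γ 1 := by rw [h21, neg_mul, mul_assoc, h22]; simp
  have hc : γ 2 * (a • (1 : A) + b • γ 0 + c • γ 1) * γ 2 = -(a • (1 : A)) + b • γ 0 + c • γ 1 := by
    simp only [mul_add, add_mul, mul_smul_comm, smul_mul_assoc, mul_one, t0, t1, h22, smul_neg]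
  have hc0 : -(a • (1 : A)) + b • γ 0 + c • γ 1 = 0 := by rw [← hc, h, mul_zero, zero_mul]
  have ha2 : (2 * a) • (1 : A) = 0 := by
    calc (2 * a) • (1 : A) = (a • (1 : A) + b • γ 0 + c • γ 1) - (-(a • (1 : A)) + b • γ 0 + c • γ 1) := by module
      _ = 0 := by rw [h, hc0, sub_zero]
  have ha : a = 0 := by
    rcases smul_eq_zero.mp ha2 with h2 | h2
    · linarith
    · exact absurd h2 one_ne_zero
  subst ha
  have hY : b • γ 0 + c • γ 1 = 0 := by simpa using h
  -- anticommute with γ₀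
  have hb2 : (2 * b) • (1 : A) = 0 := by
    have hz : γ 0 * (b • γ 0 + c • γ 1) + (b • γ 0 + c • γ 1) * γ 0 = 0 := by rw [hY, mul_zero, zero_mul, add_zero]
    have hex : γ 0 * (b • γ 0 + c • γ 1) + (b • γ 0 + c • γ 1) * γ 0 = (2 * b) • (1 : A) := by
      simp only [mul_add, add_mul, mul_smul_comm, smul_mul_assoc, h00, h01, smul_neg]
      module
    rw [hex] at hz
    exact hz
  have hb : b = 0 := by
    rcases smul_eq_zero.mp hb2 with h2 | h2
    · linarith
    · exact absurd h2 one_ne_zero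
  subst hb
  have hZ : c • γ 1 = 0 := by simpa using hY
  have hc1 : c • (γ 1 * γ 1) = 0 := by rw [← smul_mul_assoc, hZ, zero_mul]
  rw [h11, smul_neg, neg_eq_zero] at hc1
  have hc' : c = 0 := by
    rcases smul_eq_zero.mp hc1 with h2 | h2
    · exact h2
    · exact absurd h2 one_ne_zero
  exact ⟨rfl, rfl, hc'⟩

end Clifford

/-- **What the Ward identity forces on the coefficients** (the uniqueness of the decomposition (8), used tacitly when the text passes from
«Γ_μ(p,0) = −∂Σ(p)/∂p^μ» to statements about a, s): in a non-trivial γ-algebra, for every x,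
a(x) = −e·s(x), b(x) = −2e·r′(x), c(x) = −2e·s′(x), d(x) = 0.
[cite: Volkov2024PRD109, §II eqs. (8), (13), requirement 1 «The latter can be rewritten as U_j′Γ = −U_j′Σ» (arXiv v4 p.5–6; tex l.241–292)] -/
theorem WardIdentity.coeff {γ : Fin 4 → A} (hγ : IsDirac γ) [Nontrivial A] {el : ℝ} {V : Vertex} {S : SelfEnergy}
    (h : WardIdentity γ el V S) (x : ℝ) :
    V.a x = -(el * S.s x) ∧ V.b x = -(2 * el * S.r' x) ∧ V.c x = -(2 * el * S.s' x) ∧ V.d x = 0 := by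
  -- abbreviations
  set u : ℝ := (x + 1) / 2 with hu
  set v : ℝ := (x - 1) / 2 with hv
  have huv : u - v = 1 := by rw [hu, hv]; ring
  set P : A := u • γ 0 + v • γ 1 with hP
  set α : ℝ := V.a x + el * S.s x with hα
  set β : ℝ := V.b x + 2 * el * S.r' x with hβ
  set κ : ℝ := V.c x + 2 * el * S.s' x with hκ
  -- Clifford facts
  have h22 : γ 2 * γ 2 = -(1 : A) := by rw [gamma_sq hγ 2]; simp
  have h02 : γ 0 * γ 2 = -(γ 2 * γ 0) := gamma_anticomm hγ (by decide)
  have h12 : γ 1 * γ 2 = -(γ 2 * γ 1) := gamma_anticomm hγ (by decide)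
  have h01 : γ 0 * γ 1 = -(γ 1 * γ 0) := gamma_anticomm hγ (by decide)
  have h00 : γ 0 * γ 0 = (1 : A) := by rw [gamma_sq hγ 0]; simp
  have h11 : γ 1 * γ 1 = -(1 : A) := by rw [gamma_sq hγ 1]; simp
  -- the Ward identity at the test momentum, component μ, in the form X_μ = 0
  have hX : ∀ μ : Fin 4, α • γ μ + (β * lo (testMomentum x) μ) • (1 : A) + (κ * lo (testMomentum x) μ) • P
      + V.d x • (P * γ μ - γ μ * P) = 0 := by
    intro μ
    have hμ := h (testMomentum x) μ
    rw [Vertex.amp, pd_selfEnergy, dot_testMomentum, sl_testMomentum, eq_neg_iff_add_eq_zero] at hμ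
    rw [← hμ, hα, hβ, hκ, hP]
    module
  -- μ = 2 : α = 0 and d = 0
  have hPγ2 : P * γ 2 = -(γ 2 * P) := by
    rw [hP]
    simp only [add_mul, mul_add, smul_mul_assoc, mul_smul_comm, h02, h12, smul_neg, neg_add]
  have hγ2P2 : γ 2 * P * γ 2 = P := by
    rw [mul_assoc, hPγ2, mul_neg, ← mul_assoc, h22]; simp
  have h2 := hX 2
  rw [lo_testMomentum_two, mul_zero, mul_zero, zero_smul, zero_smul, add_zero, add_zero] at h2
  -- conjugate... rather multiply on the left by γ₂ and on the right by nothing: γ₂ X₂ = α γ₂² + d (γ₂ P γ₂ − γ₂² P)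
  have h2' : (-α) • (1 : A) + (2 * V.d x * u) • γ 0 + (2 * V.d x * v) • γ 1 = 0 := by
    have hm : γ 2 * (α • γ 2 + V.d x • (P * γ 2 - γ 2 * P)) = 0 := by rw [h2, mul_zero]
    have hex : γ 2 * (α • γ 2 + V.d x • (P * γ 2 - γ 2 * P)) = (-α) • (1 : A) + (2 * V.d x) • P := by
      rw [mul_add, mul_smul_comm, mul_smul_comm, h22, mul_sub, ← mul_assoc, ← mul_assoc, hγ2P2, h22]
      simp only [smul_neg, neg_mul, one_mul, sub_neg_eq_add]
      module
    rw [hex, hP, smul_add, smul_smul, smul_smul, ← add_assoc] at hm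
    exact hm
  obtain ⟨hαneg, hdu, hdv⟩ := indep_one_gamma hγ h2'
  have hα0 : α = 0 := by linarith
  have hd : V.d x = 0 := by
    have : 2 * V.d x * (u - v) = 0 := by rw [mul_sub, hdu, hdv, sub_zero]
    rw [huv, mul_one] at this
    linarith
  -- μ = 0 and μ = 1 with α = d = 0
  have h0 := hX 0
  have h1 := hX 1
  rw [hα0, hd, lo_testMomentum_zero, zero_smul, zero_smul, zero_add, add_zero, hP, smul_add, smul_smul, smul_smul,
    ← add_assoc, ← hu] at h0
  rw [hα0, hd, lo_testMomentum_one, zero_smul, zero_smul, zero_add, add_zero, hP, smul_add, smul_smul, smul_smul,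
    ← add_assoc, ← hv] at h1
  obtain ⟨hb0, hk00, hk01⟩ := indep_one_gamma hγ h0
  obtain ⟨hb1, -, hk11⟩ := indep_one_gamma hγ h1
  have hβ0 : β = 0 := by
    have e1 : β * u = 0 := hb0
    have e2 : β * v = 0 := by linear_combination -hb1
    have : β * (u - v) = 0 := by rw [mul_sub, e1, e2, sub_zero]
    rw [huv, mul_one] at this
    exact this
  have hκ0 : κ = 0 := by
    have e1 : κ * u * u = 0 := hk00
    have e2 : κ * u * v = 0 := hk01
    have e3 : κ * v * v = 0 := by linear_combination -hk11
    have ku : κ * u = 0 := by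
      have : κ * u * (u - v) = 0 := by rw [mul_sub, e1, e2, sub_zero]
      rw [huv, mul_one] at this
      exact this
    have kv : κ * v = 0 := by
      have e2' : κ * v * u = 0 := by rw [mul_right_comm]; exact e2
      have : κ * v * (u - v) = 0 := by rw [mul_sub, e2', e3, sub_zero]
      rw [huv, mul_one] at this
      exact this
    have : κ * (u - v) = 0 := by rw [mul_sub, ku, kv, sub_zero]
    rw [huv, mul_one] at this
    exact this
  refine ⟨by linarith, by linarith, by linarith, hd⟩

/-! ## §4 The operators L′, B′, M′, U′, U as printed, and «U preserves the Ward identity» -/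

/-- L′Γ = a(m²) + m b(m²) + m² c(m²) (the on-shell vertex renormalisation constant).
[cite: Volkov2024PRD109, §II «(LΓ)_μ(p,q) = [L′Γ]γ_μ, L′Γ = a(m²) + mb(m²) + m²c(m²)» (arXiv v4 p.5 L27–L28; tex l.236–240)] -/
def Vertex.lPrime (m : ℝ) (V : Vertex) : ℝ := V.a (m ^ 2) + m * V.b (m ^ 2) + m ^ 2 * V.c (m ^ 2)

/-- U′Γ = a(M²) («U_j′Γ = a(M²) … M² is an arbitrary real number»; PRD 110 (6) «(UΓ)_μ(p,q) = a(M²)γ_μ»).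
[cite: Volkov2024PRD109, §II (arXiv v4 p.6 L38–L39; tex l.302)] [cite: Volkov2024, §III eq. (6) (arXiv v2 p.8; tex l.426–428)] -/
def Vertex.uPrime (M2 : ℝ) (V : Vertex) : ℝ := V.a M2

/-- M′Σ = r(m²) + s(m²)m. [cite: Volkov2024PRD109, §II eq. (14) (arXiv v4 p.6 L19; tex l.275–277)] -/
def SelfEnergy.mPrime (m : ℝ) (S : SelfEnergy) : ℝ := S.r (m ^ 2) + S.s (m ^ 2) * m

/-- B′Σ = s(m²) + 2m ∂r(x)/∂x|_{x=m²} + 2m² ∂s(x)/∂x|_{x=m²} (the on-shell self-energy renormalisation constant of §IV A).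
[cite: Volkov2024PRD109, §IV A (arXiv v4 p.11 L22; tex l.483)] -/
def SelfEnergy.bPrime (m : ℝ) (S : SelfEnergy) : ℝ := S.s (m ^ 2) + 2 * m * S.r' (m ^ 2) + 2 * m ^ 2 * S.s' (m ^ 2)

/-- U′Σ = s(M²) — the number-valued operator for which (12) «(U_jΣ)(p) = M′Σ + (U_j′Σ)(p̸ − m)» reproduces §V's
«(U_jΣ)(p) = s(−m²)(p̸ − m) + r(m²) + s(m²)m» (M² = −m²) and PRD 110 (7) «(UΣ)(p) = r(m²) + s(m²)m + s(M²)(p̸ − m)»; §II p.6 L39 prints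
«U_j′Σ = −s(M²)» instead — see `uPrimeSecII` and the print-check theorem `uPrime_eq_neg_uPrimeSecII_iff`.
[cite: Volkov2024PRD109, §V (arXiv v4 p.20 L40; tex l.775)] [cite: Volkov2024, §III eq. (7) (arXiv v2 p.8 L41; tex l.430–432)] -/
def SelfEnergy.uPrime (M2 : ℝ) (S : SelfEnergy) : ℝ := S.s M2

/-- U′Σ AS PRINTED in §II: «U_j′Γ = a(M²), U_j′Σ = −s(M²), j = 1,2». [cite: Volkov2024PRD109, §II (arXiv v4 p.6 L38–L39; tex l.302)] -/
def SelfEnergy.uPrimeSecII (M2 : ℝ) (S : SelfEnergy) : ℝ := -S.s M2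

/-- (U_jΓ)_μ(p,q) = [U_j′Γ]γ_μ = a(M²)γ_μ (independent of p, q).
[cite: Volkov2024PRD109, §II eq. (12) (arXiv v4 p.6 L10–L14; tex l.263–269)] [cite: Volkov2024, §III eq. (6) (arXiv v2 p.8; tex l.426–428)] -/
def Vertex.uAmp (M2 : ℝ) (V : Vertex) (γ : Fin 4 → A) (_p : Fin 4 → ℝ) (μ : Fin 4) : A := V.uPrime M2 • γ μ

/-- (U_jΣ)(p) = M′Σ·1 + (U_j′Σ)(p̂ − m·1) with U_j′Σ = s(M²).
[cite: Volkov2024PRD109, §II eq. (12) (arXiv v4 p.6 L14; tex l.267–269) and §V (p.20 L40; tex l.775)] -/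
def SelfEnergy.uAmp (M2 m : ℝ) (S : SelfEnergy) (γ : Fin 4 → A) (p : Fin 4 → ℝ) : A :=
  S.mPrime m • (1 : A) + S.uPrime M2 • (sl γ p - m • (1 : A))

/-- (U_jΣ)(p) with §II's printed sign: M′Σ·1 − s(M²)(p̂ − m·1). [cite: Volkov2024PRD109, §II eq. (12) with «U_j′Σ = −s(M²)» (arXiv v4 p.6 L14, L39; tex l.267–269, l.302)] -/
def SelfEnergy.uAmpSecII (M2 m : ℝ) (S : SelfEnergy) (γ : Fin 4 → A) (p : Fin 4 → ℝ) : A :=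
  S.mPrime m • (1 : A) + S.uPrimeSecII M2 • (sl γ p - m • (1 : A))

/-- (BΣ)(p) = [B′Σ](p̂ − m) + M′Σ. [cite: Volkov2024PRD109, §IV A (arXiv v4 p.11 L22; tex l.483)] -/
def SelfEnergy.bAmp (m : ℝ) (S : SelfEnergy) (γ : Fin 4 → A) (p : Fin 4 → ℝ) : A :=
  S.bPrime m • (sl γ p - m • (1 : A)) + S.mPrime m • (1 : A)

/-- (LΓ)_μ(p,q) = [L′Γ]γ_μ. [cite: Volkov2024PRD109, §II (arXiv v4 p.5 L27–L28; tex l.236–240)] -/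
def Vertex.lAmp (m : ℝ) (V : Vertex) (γ : Fin 4 → A) (_p : Fin 4 → ℝ) (μ : Fin 4) : A := V.lPrime m • γ μ

/-- **PRD 110 eq. (7) literally**: (UΣ)(p) = r(m²) + s(m²)m + s(M²)(p̸ − m). [cite: Volkov2024, §III eq. (7) (arXiv v2 p.8 L41; tex l.430–432)] -/
theorem SelfEnergy.uAmp_eq_PRD110 (M2 m : ℝ) (S : SelfEnergy) (γ : Fin 4 → A) (p : Fin 4 → ℝ) :
    S.uAmp M2 m γ p = S.r (m ^ 2) • (1 : A) + (S.s (m ^ 2) * m) • (1 : A) + S.s M2 • (sl γ p - m • (1 : A)) := by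
  simp only [SelfEnergy.uAmp, SelfEnergy.mPrime, SelfEnergy.uPrime, add_smul]

/-- **§V's display**: at M² = −m², (U_jΣ)(p) = s(−m²)(p̸ − m) + r(m²) + s(m²)m. [cite: Volkov2024PRD109, §V (arXiv v4 p.20 L40; tex l.775)] -/
theorem SelfEnergy.uAmp_secV (m : ℝ) (S : SelfEnergy) (γ : Fin 4 → A) (p : Fin 4 → ℝ) :
    S.uAmp (-(m ^ 2)) m γ p = S.s (-(m ^ 2)) • (sl γ p - m • (1 : A)) + S.r (m ^ 2) • (1 : A) + (S.s (m ^ 2) * m) • (1 : A) := by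
  simp only [SelfEnergy.uAmp, SelfEnergy.mPrime, SelfEnergy.uPrime, add_smul]
  abel

/-- **«In old calculations we used M² = m²»**: at M² = m² the operator (7) is (UΣ)(p) = r(m²) + s(m²)p̸, the 2015–2019 operator
(PRD 100 §II «UΣ(p) = u(m²) + v(m²)p̂»). [cite: Volkov2024, §III «In old calculations we used M² = m²» (arXiv v2 p.8; tex l.441)] -/
theorem SelfEnergy.uAmp_self (m : ℝ) (S : SelfEnergy) (γ : Fin 4 → A) (p : Fin 4 → ℝ) :
    S.uAmp (m ^ 2) m γ p = S.r (m ^ 2) • (1 : A) + S.s (m ^ 2) • sl γ p := by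
  simp only [SelfEnergy.uAmp, SelfEnergy.mPrime, SelfEnergy.uPrime, smul_sub, smul_smul, add_smul]
  module

/-- t ↦ C·1 + K·((p + t e_μ)^ − m·1) has derivative K·γ_μ: the common calculus of (UΣ), (BΣ). [folklore] -/
private theorem hasDerivAt_affine_slash (γ : Fin 4 → A) (C K m : ℝ) (p : Fin 4 → ℝ) (μ : Fin 4) :
    HasDerivAt (fun t : ℝ => C • (1 : A) + K • (sl γ (p + t • e μ) - m • (1 : A))) (K • γ μ) 0 := by
  have h1 : HasDerivAt (fun t : ℝ => (C • (1 : A) + K • sl γ p - (K * m) • (1 : A)) + t • (K • γ μ)) ((1 : ℝ) • (K • γ μ)) 0 :=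
    ((hasDerivAt_id' (0 : ℝ)).smul_const (K • γ μ)).const_add _
  have hfun : (fun t : ℝ => C • (1 : A) + K • (sl γ (p + t • e μ) - m • (1 : A)))
      = fun t : ℝ => (C • (1 : A) + K • sl γ p - (K * m) • (1 : A)) + t • (K • γ μ) := by
    funext t; rw [sl_add_smul_e]; module
  rw [hfun]
  refine h1.congr_deriv ?_
  rw [one_smul]

/-- ∂(U_jΣ)(p)/∂p^μ = [U_j′Σ]γ_μ = s(M²)γ_μ. [cite: Volkov2024PRD109, §II requirement 1 «The latter can be rewritten as U_j′Γ = −U_j′Σ» (arXiv v4 p.6 L27–L30; tex l.290–294)] -/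
theorem SelfEnergy.pd_uAmp (M2 m : ℝ) (S : SelfEnergy) (γ : Fin 4 → A) (p : Fin 4 → ℝ) (μ : Fin 4) :
    pd (S.uAmp M2 m γ) p μ = S.uPrime M2 • γ μ :=
  (hasDerivAt_affine_slash γ _ _ m p μ).deriv

/-- ∂(U_jΣ)^{§II}(p)/∂p^μ = −s(M²)γ_μ. [cite: Volkov2024PRD109, §II eq. (12) with l.302's sign (arXiv v4 p.6 L14, L39; tex l.267–269, l.302)] -/
theorem SelfEnergy.pd_uAmpSecII (M2 m : ℝ) (S : SelfEnergy) (γ : Fin 4 → A) (p : Fin 4 → ℝ) (μ : Fin 4) :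
    pd (S.uAmpSecII M2 m γ) p μ = S.uPrimeSecII M2 • γ μ :=
  (hasDerivAt_affine_slash γ _ _ m p μ).deriv

/-- ∂(BΣ)(p)/∂p^μ = [B′Σ]γ_μ. [cite: Volkov2024PRD109, §IV A (arXiv v4 p.11 L22; tex l.483)] -/
theorem SelfEnergy.pd_bAmp (m : ℝ) (S : SelfEnergy) (γ : Fin 4 → A) (p : Fin 4 → ℝ) (μ : Fin 4) :
    pd (S.bAmp m γ) p μ = S.bPrime m • γ μ := by
  have h := (hasDerivAt_affine_slash γ (S.mPrime m) (S.bPrime m) m p μ).deriv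
  have hfun : (fun t : ℝ => S.mPrime m • (1 : A) + S.bPrime m • (sl γ (p + t • e μ) - m • (1 : A)))
      = fun t : ℝ => S.bAmp m γ (p + t • e μ) := by
    funext t; simp only [SelfEnergy.bAmp]; abel
  rw [hfun] at h
  exact h

variable {γ : Fin 4 → A}

/-- **«U_j′Γ = −U_j′Σ»** (requirement 1 rewritten; §IV B «The corollary is U₁′Γ₁ + U₁′Σ₁ = 0») — with U′Σ = s(M²): for every Ward pair,
a(M²) = −e·s(M²). [cite: Volkov2024PRD109, §II requirement 1 (arXiv v4 p.6 L27–L30; tex l.290–294); §IV B corollaries (p.12; tex l.546–548)] -/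
theorem uPrime_vertex_eq (hγ : IsDirac γ) [Nontrivial A] {el : ℝ} {V : Vertex} {S : SelfEnergy}
    (h : WardIdentity γ el V S) (M2 : ℝ) : V.uPrime M2 = -(el * S.uPrime M2) :=
  (h.coeff hγ M2).1

/-- **PRD 110 §III / PRD 109 §II requirement 1 — «U preserves the Ward identity»**: if Γ_μ(p,0) = −e ∂Σ(p)/∂p^μ then
(UΓ)_μ(p,0) = −e ∂(UΣ)(p)/∂p^μ, for (6) (UΓ)_μ = a(M²)γ_μ and (7) (UΣ)(p) = r(m²) + s(m²)m + s(M²)(p̸ − m), EVERY M² and m, in every non-trivial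
normed real γ-algebra. [cite: Volkov2024, §III «then (UΓ)_μ(p,0) = −e ∂(UΣ)(p)/∂p^μ is also satisfied» (arXiv v2 p.8 L42–L44; tex l.433–441)]
[cite: Volkov2024PRD109, §II requirement 1 (arXiv v4 p.6 L20–L27; tex l.281–290)] -/
theorem u_preserves_ward (hγ : IsDirac γ) [Nontrivial A] {el : ℝ} {V : Vertex} {S : SelfEnergy}
    (h : WardIdentity γ el V S) (M2 m : ℝ) (p : Fin 4 → ℝ) (μ : Fin 4) :
    V.uAmp M2 γ p μ = -(el • pd (S.uAmp M2 m γ) p μ) := by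
  rw [Vertex.uAmp, SelfEnergy.pd_uAmp, uPrime_vertex_eq hγ h M2, smul_smul, neg_smul]

/-- **PRINT-CHECK DATUM (§II p.6 L39 «U_j′Σ = −s(M²)» vs §V p.20 L40 / PRD 110 (7) «+s(M²)»)**: with §II's printed sign, requirement 1
«U_j′Γ = −U_j′Σ» holds for a Ward pair (e = 1) IF AND ONLY IF s(M²) = 0; i.e. it fails for every Ward pair with s(M²) ≠ 0, whereas with
U′Σ = s(M²) (`uPrime_vertex_eq`) it holds for all of them. [cite: Volkov2024PRD109, §II (arXiv v4 p.6 L27–L30, L38–L39; tex l.290–302) and §V (p.20 L40; tex l.775)] -/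
theorem uPrime_eq_neg_uPrimeSecII_iff (hγ : IsDirac γ) [Nontrivial A] {V : Vertex} {S : SelfEnergy}
    (h : WardIdentity γ 1 V S) (M2 : ℝ) : V.uPrime M2 = -(S.uPrimeSecII M2) ↔ S.s M2 = 0 := by
  rw [uPrime_vertex_eq hγ h M2, SelfEnergy.uPrime, SelfEnergy.uPrimeSecII, neg_neg, one_mul]
  constructor
  · intro h2; linarith
  · intro h2; rw [h2, neg_zero]

/-- The same datum at the amplitude level: with §II's sign, «(U_jΓ)_μ(p,0) = −∂[(U_jΣ)(p)]/∂p^μ» holds at (p, μ) iff s(M²) = 0.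
[cite: Volkov2024PRD109, §II requirement 1 and l.302 (arXiv v4 p.6 L20–L39; tex l.281–302)] -/
theorem uAmpSecII_preserves_ward_iff (hγ : IsDirac γ) [Nontrivial A] {V : Vertex} {S : SelfEnergy}
    (h : WardIdentity γ 1 V S) (M2 m : ℝ) (p : Fin 4 → ℝ) (μ : Fin 4) :
    V.uAmp M2 γ p μ = -((1 : ℝ) • pd (S.uAmpSecII M2 m γ) p μ) ↔ S.s M2 = 0 := by
  rw [Vertex.uAmp, SelfEnergy.pd_uAmpSecII, uPrime_vertex_eq hγ h M2, SelfEnergy.uPrime, SelfEnergy.uPrimeSecII, one_smul,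
    one_mul, neg_smul, neg_neg, neg_eq_iff_add_eq_zero, ← add_smul]
  constructor
  · intro h3
    rcases smul_eq_zero.mp h3 with h4 | h4
    · linarith
    · exfalso
      have : γ μ * γ μ = 0 := by rw [h4, zero_mul]
      rw [gamma_sq hγ μ] at this
      rcases smul_eq_zero.mp this with h5 | h5
      · have := η_mul_self μ; rw [h5, zero_mul] at this; exact zero_ne_one this
      · exact one_ne_zero h5
  · intro h2; rw [h2, add_zero, zero_smul]

/-- **§IV B: «L′Γ₁ = −B′Σ₁»** (with e: L′Γ = −e·B′Σ) for every Ward pair — the identity that makes «the difference between our and on-shell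
contributions» vanish. [cite: Volkov2024PRD109, §IV B «It equals 0, because L′Γ₁ = −B′Σ₁» (arXiv v4 p.14 L15; tex l.595)] -/
theorem lPrime_eq_neg_bPrime (hγ : IsDirac γ) [Nontrivial A] {el : ℝ} {V : Vertex} {S : SelfEnergy}
    (h : WardIdentity γ el V S) (m : ℝ) : V.lPrime m = -(el * S.bPrime m) := by
  obtain ⟨ha, hb, hc, -⟩ := h.coeff hγ (m ^ 2)
  simp only [Vertex.lPrime, SelfEnergy.bPrime, ha, hb, hc]
  ring

/-- L and B at the amplitude level: (LΓ)_μ(p,q) = −e ∂(BΣ)(p)/∂p^μ for every Ward pair. [cite: Volkov2024PRD109, §IV A–B (arXiv v4 p.11 L22, p.14 L15; tex l.483, l.595)] -/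
theorem lAmp_eq_neg_pd_bAmp (hγ : IsDirac γ) [Nontrivial A] {el : ℝ} {V : Vertex} {S : SelfEnergy}
    (h : WardIdentity γ el V S) (m : ℝ) (p : Fin 4 → ℝ) (μ : Fin 4) :
    V.lAmp m γ p μ = -(el • pd (S.bAmp m γ) p μ) := by
  rw [Vertex.lAmp, SelfEnergy.pd_bAmp, lPrime_eq_neg_bPrime hγ h m, smul_smul, neg_smul]

/-- The zero self-energy shape (r ≡ s ≡ 0), whose Ward partner condition reads «Γ_μ(p,0) = 0». [folklore] -/
def SelfEnergy.zero : SelfEnergy :=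
  ⟨fun _ => 0, fun _ => 0, fun _ => 0, fun _ => 0, fun x => hasDerivAt_const x (0 : ℝ), fun x => hasDerivAt_const x (0 : ℝ)⟩

/-- ∂0/∂p^μ = 0. [folklore] -/
private theorem pd_zero_amp (γ : Fin 4 → A) (p : Fin 4 → ℝ) (μ : Fin 4) : pd (SelfEnergy.zero.amp γ) p μ = 0 := by
  rw [pd_selfEnergy]; simp [SelfEnergy.zero]

/-- **Requirement 2: «If Γ_μ(p,0) = 0, then U′_jΓ = 0 (j = 1,2,3)»** — for U_j′Γ = a(M²) and for the alternative U₃′Γ = L′Γ («As U₃′Γ we can take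
a(M²) or L′Γ»): a vertexlike amplitude of the form (8) that vanishes identically has a ≡ b ≡ c ≡ d ≡ 0 (`WardIdentity.coeff` with Σ = 0), so both
vanish. [cite: Volkov2024PRD109, §II requirement 2 and «As U₃′Γ we can take a(M²) or L′Γ» (arXiv v4 p.6 L31, L40; tex l.293, l.306)] -/
theorem uPrime_lPrime_eq_zero_of_amp_eq_zero (hγ : IsDirac γ) [Nontrivial A] {V : Vertex}
    (hV : ∀ (p : Fin 4 → ℝ) (μ : Fin 4), V.amp γ p μ = 0) (M2 m : ℝ) : V.uPrime M2 = 0 ∧ V.lPrime m = 0 := by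
  have hW : WardIdentity γ 1 V SelfEnergy.zero := fun p μ => by rw [hV, pd_zero_amp, smul_zero, neg_zero]
  obtain ⟨ha, -, -, -⟩ := hW.coeff hγ M2
  obtain ⟨ha', hb', hc', -⟩ := hW.coeff hγ (m ^ 2)
  simp only [SelfEnergy.zero, mul_zero, neg_zero] at ha ha' hb' hc'
  refine ⟨ha, ?_⟩
  simp only [Vertex.lPrime, ha', hb', hc', mul_zero, add_zero]

/-! ## §5 The per-graph Ward identities of §IV B (weighted families) and their corollaries; B.61's cancellation from them -/

/-- A printed per-graph Ward identity of §IV B: ONE self-energy graph Σ and the vertexlike graphs Γ_i obtained by inserting the external photon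
into a main-path line, with integer weights («Each coefficient equals 1, but some of our coefficients equal 2, because we are working with undirected
Feynman graphs»): Σ_i w_i (Γ_i)_μ(p,0) + ∂Σ(p)/∂p^μ = 0.
[cite: Volkov2024PRD109, §IV B «We use the following Ward identities for individual graphs: (Γ₁)_μ(p,0) + ∂Σ₁(p)/∂p^μ = 0, 2(Γ_M)_μ(p,0) + ∂Σ_M(p)/∂p^μ = 0, 2(Γ_λ)_μ(p,0) + (Γ_×)_μ(p,0) + ∂Σ_×(p)/∂p^μ = 0, …» (arXiv v4 p.12; tex l.538–545)] -/
def WardFamily (γ : Fin 4 → A) {n : ℕ} (w : Fin n → ℝ) (V : Fin n → Vertex) (S : SelfEnergy) : Prop :=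
  ∀ (p : Fin 4 → ℝ) (μ : Fin 4), ∑ i, w i • (V i).amp γ p μ + pd (S.amp γ) p μ = 0

/-- The weighted sum Σ_i w_i Γ_i of vertexlike amplitudes of the form (8) is again of the form (8), coefficientwise. [folklore] -/
def Vertex.comb {n : ℕ} (w : Fin n → ℝ) (V : Fin n → Vertex) : Vertex where
  a := fun x => ∑ i, w i * (V i).a x
  b := fun x => ∑ i, w i * (V i).b x
  c := fun x => ∑ i, w i * (V i).c x
  d := fun x => ∑ i, w i * (V i).d x

/-- (Σ_i w_i Γ_i)_μ(p,0) = Σ_i w_i (Γ_i)_μ(p,0). [folklore] -/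
private theorem Vertex.amp_comb (γ : Fin 4 → A) {n : ℕ} (w : Fin n → ℝ) (V : Fin n → Vertex) (p : Fin 4 → ℝ) (μ : Fin 4) :
    (Vertex.comb w V).amp γ p μ = ∑ i, w i • (V i).amp γ p μ := by
  simp only [Vertex.amp, Vertex.comb, Finset.sum_mul, Finset.sum_smul, smul_add, smul_smul, ← Finset.sum_add_distrib, mul_assoc]

/-- A weighted family identity is the Ward identity (e = 1) for the pair (Σ_i w_i Γ_i, Σ). [cite: Volkov2024PRD109, §IV B (arXiv v4 p.12; tex l.538–545)] -/
theorem WardFamily.wardIdentity {n : ℕ} {w : Fin n → ℝ} {V : Fin n → Vertex} {S : SelfEnergy}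
    (h : WardFamily γ w V S) : WardIdentity γ 1 (Vertex.comb w V) S := by
  intro p μ
  rw [Vertex.amp_comb, one_smul, eq_neg_iff_add_eq_zero]
  exact h p μ

/-- **«The corollary is U₁′Γ₁ + U₁′Σ₁ = 0, 2U₁′Γ_M + U₁′Σ_M = 0, 2U₁′Γ_λ + U₁′Γ_× + U₁′Σ_× = 0, 2U₁′Γ_ρ + U₁′Γ_≈ + U₁′Σ_≈ = 0»** — in general:
Σ_i w_i U′Γ_i + U′Σ = 0 for every weighted Ward family (U′Γ = a(M²), U′Σ = s(M²)).
[cite: Volkov2024PRD109, §IV B «The corollary is …» (arXiv v4 p.12; tex l.546–548)] -/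
theorem WardFamily.uPrime_corollary (hγ : IsDirac γ) [Nontrivial A] {n : ℕ} {w : Fin n → ℝ} {V : Fin n → Vertex} {S : SelfEnergy}
    (h : WardFamily γ w V S) (M2 : ℝ) : ∑ i, w i * (V i).uPrime M2 + S.uPrime M2 = 0 := by
  have := uPrime_vertex_eq hγ h.wardIdentity M2
  simp only [Vertex.uPrime, Vertex.comb, SelfEnergy.uPrime, one_mul] at this ⊢
  rw [this, neg_add_cancel]

/-- **«From this it follows that all terms with U₁′ are cancelled»** — now from the PRINTED WARD IDENTITIES THEMSELVES: for the ten amplitudes of the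
3-loop class (arXiv FIG. 6: Γ₁, Γ_λ, Γ_ρ, Γ_×, Γ_≈, Γ_M; Σ₁, Σ_×, Σ_≈, Σ_M) satisfying the four printed identities, and ANY values of A′Γ₁, A′Γ_λ,
A′Γ_ρ, A′Γ_M, M′Σ₁, the sum of the ten rows of TABLE I with U₁′ evaluated as U′ at any M² (`OnShellEquivalenceWardCancellation`'s `tableSum`) is 0.
[cite: Volkov2024PRD109, §IV B (arXiv v4 p.12; tex l.531–549)] -/
theorem tableSum_eq_zero_of_wardFamilies (hγ : IsDirac γ) [Nontrivial A] (M2 : ℝ)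
    {G1 Gl Gr Gx Ga GM : Vertex} {S1 Sx Sa SM : SelfEnergy}
    (h1 : WardFamily γ ![1] ![G1] S1) (hM : WardFamily γ ![2] ![GM] SM)
    (hx : WardFamily γ ![2, 1] ![Gl, Gx] Sx) (ha : WardFamily γ ![2, 1] ![Gr, Ga] Sa)
    (aG1 aGl aGr aGM mS1 : ℝ) :
    ({ aG1 := aG1, aGl := aGl, aGr := aGr, aGM := aGM,
       uG1 := G1.uPrime M2, uGl := Gl.uPrime M2, uGr := Gr.uPrime M2, uGx := Gx.uPrime M2, uGa := Ga.uPrime M2,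
       uGM := GM.uPrime M2, uS1 := S1.uPrime M2, uSx := Sx.uPrime M2, uSa := Sa.uPrime M2, uSM := SM.uPrime M2,
       mS1 := mS1 } : Set3Values ℝ).tableSum = 0 := by
  have c1 := h1.uPrime_corollary hγ M2
  have cM := hM.uPrime_corollary hγ M2
  have cx := hx.uPrime_corollary hγ M2
  have ca := ha.uPrime_corollary hγ M2
  simp only [Fin.sum_univ_one, Fin.sum_univ_two, Matrix.cons_val_zero, Matrix.cons_val_one, one_mul] at c1 cM cx ca
  exact Set3Values.tableSum_eq_zero_of_ward _ c1 cM cx ca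

end WardPreservation

/-! ## §6 The model: the Dirac matrices (`Volkov2020.DiracModel`) — the hypotheses are met, the theorems have content -/

namespace WardPreservation

open Volkov2020.DiracModel

section Model

-- Mathlib keeps the matrix norms non-global; the ℓ∞-operator norm is switched on section-locally (as in `Volkov2020.DiracMatrixModel`).
attribute [local instance] Matrix.linftyOpNormedRing Matrix.linftyOpNormedAlgebra

/-- In M₄(ℂ) with the Dirac matrices: U preserves the Ward identity (PRD 110 §III), for every Ward pair, every M², m.
[cite: Volkov2024, §III (arXiv v2 p.8 L42–L44; tex l.433–441)] -/
theorem model_u_preserves_ward {el : ℝ} {V : Vertex} {S : SelfEnergy} (h : WardIdentity diracGamma el V S)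
    (M2 m : ℝ) (p : Fin 4 → ℝ) (μ : Fin 4) :
    V.uAmp M2 diracGamma p μ = -(el • pd (S.uAmp M2 m diracGamma) p μ) :=
  u_preserves_ward isDirac_diracGamma h M2 m p μ

/-- … and Ward pairs exist there for every Σ (non-vacuity of the hypothesis in the model). [cite: Volkov2024PRD109, §II requirement 1 (arXiv v4 p.6; tex l.281–290)] -/
theorem model_wardIdentity (el : ℝ) (S : SelfEnergy) : WardIdentity diracGamma el (S.wardVertex el) S :=
  wardIdentity_wardVertex diracGamma el S

/-- … and the print-check datum is live there: for every Ward pair of M₄(ℂ) with s(M²) ≠ 0, p.6 L39's «U_j′Σ = −s(M²)» violates requirement 1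
«U_j′Γ = −U_j′Σ». [cite: Volkov2024PRD109, §II (arXiv v4 p.6 L27–L39; tex l.290–302)] -/
theorem model_secII_sign_fails {V : Vertex} {S : SelfEnergy} (h : WardIdentity diracGamma 1 V S) {M2 : ℝ} (hs : S.s M2 ≠ 0) :
    V.uPrime M2 ≠ -(S.uPrimeSecII M2) := fun hEq =>
  hs ((uPrime_eq_neg_uPrimeSecII_iff isDirac_diracGamma h M2).mp hEq)

end Model

end WardPreservation

end Literature.MathematicalPhysics.QuantumFieldTheory.Volkov2024PRD109

end
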